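import Mathlib
import Summits.Ventures.PercRepro2.TypedPendantRootSeries

/-!
# The pendant-root cone at a series root: the mark-like corner as a theorem, and the upper bound
as the lower bounds one subdivision away (blind cell PercRepro2, mine-2 g51, 2026-08-29;
`conjectures/MINE-2.md` M2-108)

From the exact bases of `TypedPendantRootSeries.lean` (`f = {a₁, u}` the leaf edge of the root,
`e = {u, v}` the one further typed edge at the unmarked `u`; `M_j` the bases of the contracted
instance, the root hanging at `v`):

* **`pendant_root_series_one_corner`** (`τ e = 1`): `N₁ = N₃` and `N₂ = 2·N₃` — the MARK-LIKE
  CORNER of (PM-ROOT) (M2-107 add. 1: `n₁ = n₂ = n₃`) is a THEOREM at every class-`1` series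
  root: the equality case of both lower bounds and of the upper bound at once;
* **`pmRoot_series_two_iff`** / **`upper_series_two_iff`** (`τ e = 2`): at a class-`2` series root
  the two lower bounds `N₃ ≤ N₁ ∧ 2·N₃ ≤ N₂`, and likewise the upper bound `N₂ ≤ 2·N₁`, are each
  EQUIVALENT to the upper bound `M₂ ≤ 2·M₁` one contraction down;
* **`PMRootUpper`** records the upper half `N₂ ≤ 2·N₁` of the cone `N₃ ≤ N₂/2 ≤ N₁` as a Prop
  beside `PMRoot` (a candidate, NOT asserted; 0 violations on 911,215,616 class vectors at
  `n = 7`, engine g47); **`upper_contracted_of_PMRoot`**: under `PMRoot` it holds at every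
  instance that is the contraction of a class-`2` series pendant root — on paper every
  pendant-root instance is such a contraction (subdivide its leaf edge), so the upper half of the
  cone is not an independent candidate; **`pmRoot_series_two_of_PMRootUpper`** is the converse at
  the series roots.

Own work; standard axioms; nothing here asserts a candidate.
-/

namespace Summit.Ventures.PercRepro2

open UnionCluster

namespace CovForm

namespace TypedRed

open OneTyped TypedA3 Untouched

/-! ## The corner and the two equivalences -/

section Cone

open Classical

variable {V : Type*} {E : Type*} [Fintype E] [DecidableEq E] {R : Type*} [Field R]
  [LinearOrder R] [IsStrictOrderedRing R]
variable (ends : E → Sym2 V) (o a₁ a₂ a₃ b : V)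

/-- **The mark-like corner is a theorem at a class-`1` series root**: `N₁ = N₃` and `N₂ = 2·N₃` —
the equality case of both lower bounds of (PM-ROOT) (and of the upper bound `N₂ ≤ 2·N₁`). -/
theorem pendant_root_series_one_corner {f e : E} (hef : e ≠ f) {u v : V} (hf : ends f = s(a₁, u))
    (hleaf : ∀ e', a₁ ∈ ends e' → e' = f) (he : ends e = s(u, v)) (hu1 : u ≠ a₁) (huv : u ≠ v)
    (huo : u ≠ o) (hu2 : u ≠ a₂) (hu3 : u ≠ a₃) (hub : u ≠ b) (F : Finset E) (hfF : f ∈ F)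
    (heF : e ∈ F) (z : Config E) (τ : E → ℕ) (hτ : ∀ e' ∈ F, τ e' = 1 ∨ τ e' = 2) (hτe : τ e = 1)
    (hcl : ∀ e', e' ≠ f → e' ≠ e → u ∈ ends e' → e' ∉ F ∧ z e' = false) :
    typedCount F z (Function.update τ f 1)
          (K3 ends o a₁ a₂ a₃ b : Config E → Config E → Config E → R) =
        typedCount F z (Function.update τ f 3) (K3 ends o a₁ a₂ a₃ b) ∧
      typedCount F z (Function.update τ f 2)
          (K3 ends o a₁ a₂ a₃ b : Config E → Config E → Config E → R) =
        2 * typedCount F z (Function.update τ f 3) (K3 ends o a₁ a₂ a₃ b) := by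
  obtain ⟨h1, h2, h3⟩ := pendant_root_series_one (R := R) ends o a₁ a₂ a₃ b hef hf hleaf he hu1 huv huo
    hu2 hu3 hub F hfF heF z τ hτ hτe hcl
  rw [h1, h2, h3]
  exact ⟨rfl, rfl⟩

/-- **At a class-`2` series root the two lower bounds of (PM-ROOT) are the upper bound one
contraction down**: `N₃ ≤ N₁ ∧ 2·N₃ ≤ N₂ ↔ M₂ ≤ 2·M₁`. -/
theorem pmRoot_series_two_iff {f e : E} (hef : e ≠ f) {u v : V} (hf : ends f = s(a₁, u))
    (hleaf : ∀ e', a₁ ∈ ends e' → e' = f) (he : ends e = s(u, v)) (hu1 : u ≠ a₁) (huv : u ≠ v)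
    (huo : u ≠ o) (hu2 : u ≠ a₂) (hu3 : u ≠ a₃) (hub : u ≠ b) (F : Finset E) (hfF : f ∈ F)
    (heF : e ∈ F) (z : Config E) (τ : E → ℕ) (hτ : ∀ e' ∈ F, τ e' = 1 ∨ τ e' = 2) (hτe : τ e = 2)
    (hcl : ∀ e', e' ≠ f → e' ≠ e → u ∈ ends e' → e' ∉ F ∧ z e' = false) :
    (typedCount F z (Function.update τ f 3)
          (K3 ends o a₁ a₂ a₃ b : Config E → Config E → Config E → R) ≤
        typedCount F z (Function.update τ f 1) (K3 ends o a₁ a₂ a₃ b) ∧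
      2 * typedCount F z (Function.update τ f 3)
          (K3 ends o a₁ a₂ a₃ b : Config E → Config E → Config E → R) ≤
        typedCount F z (Function.update τ f 2) (K3 ends o a₁ a₂ a₃ b)) ↔
      typedCount (F.erase e) (Function.update z e true) (Function.update τ f 2)
          (K3 ends o a₁ a₂ a₃ b : Config E → Config E → Config E → R) ≤
        2 * typedCount (F.erase e) (Function.update z e true) (Function.update τ f 1)
          (K3 ends o a₁ a₂ a₃ b) := by
  obtain ⟨h1, h2, h3⟩ := pendant_root_series_two (R := R) ends o a₁ a₂ a₃ b hef hf hleaf he hu1 huv huo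
    hu2 hu3 hub F hfF heF z τ hτ hτe hcl
  rw [h1, h2, h3]
  constructor
  · rintro ⟨h, -⟩; exact h
  · intro h; exact ⟨h, by linarith⟩

/-- **At a class-`2` series root the upper bound is the upper bound one contraction down**:
`N₂ ≤ 2·N₁ ↔ M₂ ≤ 2·M₁`. -/
theorem upper_series_two_iff {f e : E} (hef : e ≠ f) {u v : V} (hf : ends f = s(a₁, u))
    (hleaf : ∀ e', a₁ ∈ ends e' → e' = f) (he : ends e = s(u, v)) (hu1 : u ≠ a₁) (huv : u ≠ v)
    (huo : u ≠ o) (hu2 : u ≠ a₂) (hu3 : u ≠ a₃) (hub : u ≠ b) (F : Finset E) (hfF : f ∈ F)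
    (heF : e ∈ F) (z : Config E) (τ : E → ℕ) (hτ : ∀ e' ∈ F, τ e' = 1 ∨ τ e' = 2) (hτe : τ e = 2)
    (hcl : ∀ e', e' ≠ f → e' ≠ e → u ∈ ends e' → e' ∉ F ∧ z e' = false) :
    typedCount F z (Function.update τ f 2)
          (K3 ends o a₁ a₂ a₃ b : Config E → Config E → Config E → R) ≤
        2 * typedCount F z (Function.update τ f 1) (K3 ends o a₁ a₂ a₃ b) ↔
      typedCount (F.erase e) (Function.update z e true) (Function.update τ f 2)
          (K3 ends o a₁ a₂ a₃ b : Config E → Config E → Config E → R) ≤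
        2 * typedCount (F.erase e) (Function.update z e true) (Function.update τ f 1)
          (K3 ends o a₁ a₂ a₃ b) := by
  obtain ⟨h1, h2, -⟩ := pendant_root_series_two (R := R) ends o a₁ a₂ a₃ b hef hf hleaf he hu1 huv huo
    hu2 hu3 hub F hfF heF z τ hτ hτe hcl
  rw [h1, h2]
  constructor <;> intro h <;> linarith

end Cone

/-! ## The upper bound as a Prop, and its derivation from (PM-ROOT) one subdivision up -/

section Upper

open Classical

/-- **The upper half of the pendant-root cone as a Prop** (M2-107 add. 1: `N₂ ≤ 2·N₁`; 0 violations
on 911,215,616 class vectors at `n = 7`, engine g47) — a CANDIDATE of record, NOT asserted. -/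
def PMRootUpper (R : Type*) [Field R] [LinearOrder R] : Prop :=
  ∀ (V E : Type) [Fintype E] [DecidableEq E] (ends : E → Sym2 V) (o a₁ a₂ a₃ b u : V) (f : E),
    ends f = s(a₁, u) → (∀ e, a₁ ∈ ends e → e = f) →
    a₁ ≠ u → a₁ ≠ o → a₁ ≠ a₂ → a₁ ≠ a₃ → a₁ ≠ b → u ≠ o → u ≠ a₂ → u ≠ a₃ → u ≠ b →
    ∀ (F : Finset E), f ∈ F → ∀ (z : Config E) (τ : E → ℕ), (∀ e ∈ F, τ e = 1 ∨ τ e = 2) →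
      typedCount F z (Function.update τ f 2)
          (K3 ends o a₁ a₂ a₃ b : Config E → Config E → Config E → R) ≤
        2 * typedCount F z (Function.update τ f 1) (K3 ends o a₁ a₂ a₃ b)

variable {V E : Type} [Fintype E] [DecidableEq E] {R : Type*} [Field R] [LinearOrder R]
  [IsStrictOrderedRing R]
variable (ends : E → Sym2 V) (o a₁ a₂ a₃ b : V)

/-- **(PM-ROOT) one subdivision up gives the upper bound**: under `PMRoot`, every instance that is
the contraction of a class-`2` series pendant root satisfies `M₂ ≤ 2·M₁` — the upper half of the
cone is not an independent candidate (on paper every pendant-root instance is such a contraction: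
subdivide its leaf edge). -/
theorem upper_contracted_of_PMRoot (hPM : PMRoot R) {f e : E} (hef : e ≠ f) {u v : V}
    (hf : ends f = s(a₁, u)) (hleaf : ∀ e', a₁ ∈ ends e' → e' = f) (he : ends e = s(u, v))
    (h1u : a₁ ≠ u) (h1o : a₁ ≠ o) (h12 : a₁ ≠ a₂) (h13 : a₁ ≠ a₃) (h1b : a₁ ≠ b) (huv : u ≠ v)
    (huo : u ≠ o) (hu2 : u ≠ a₂) (hu3 : u ≠ a₃) (hub : u ≠ b) (F : Finset E) (hfF : f ∈ F)
    (heF : e ∈ F) (z : Config E) (τ : E → ℕ) (hτ : ∀ e' ∈ F, τ e' = 1 ∨ τ e' = 2) (hτe : τ e = 2)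
    (hcl : ∀ e', e' ≠ f → e' ≠ e → u ∈ ends e' → e' ∉ F ∧ z e' = false) :
    typedCount (F.erase e) (Function.update z e true) (Function.update τ f 2)
        (K3 ends o a₁ a₂ a₃ b : Config E → Config E → Config E → R) ≤
      2 * typedCount (F.erase e) (Function.update z e true) (Function.update τ f 1)
        (K3 ends o a₁ a₂ a₃ b) :=
  (pmRoot_series_two_iff ends o a₁ a₂ a₃ b hef hf hleaf he h1u.symm huv huo hu2 hu3 hub F hfF heF
    z τ hτ hτe hcl).1
    (hPM V E ends o a₁ a₂ a₃ b u f hf hleaf h1u h1o h12 h13 h1b huo hu2 hu3 hub F hfF z τ hτ)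

/-- **The upper bound one contraction down gives (PM-ROOT) at a class-`2` series root**: under
`PMRootUpper` the two lower bounds hold at every class-`2` series pendant root. -/
theorem pmRoot_series_two_of_PMRootUpper (hU : PMRootUpper R) {f e : E} (hef : e ≠ f) {u v : V}
    (hf : ends f = s(a₁, u)) (hleaf : ∀ e', a₁ ∈ ends e' → e' = f) (he : ends e = s(u, v))
    (h1u : a₁ ≠ u) (h1o : a₁ ≠ o) (h12 : a₁ ≠ a₂) (h13 : a₁ ≠ a₃) (h1b : a₁ ≠ b) (huv : u ≠ v)
    (huo : u ≠ o) (hu2 : u ≠ a₂) (hu3 : u ≠ a₃) (hub : u ≠ b) (F : Finset E) (hfF : f ∈ F)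
    (heF : e ∈ F) (z : Config E) (τ : E → ℕ) (hτ : ∀ e' ∈ F, τ e' = 1 ∨ τ e' = 2) (hτe : τ e = 2)
    (hcl : ∀ e', e' ≠ f → e' ≠ e → u ∈ ends e' → e' ∉ F ∧ z e' = false) :
    typedCount F z (Function.update τ f 3)
          (K3 ends o a₁ a₂ a₃ b : Config E → Config E → Config E → R) ≤
        typedCount F z (Function.update τ f 1) (K3 ends o a₁ a₂ a₃ b) ∧
      2 * typedCount F z (Function.update τ f 3)
          (K3 ends o a₁ a₂ a₃ b : Config E → Config E → Config E → R) ≤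
        typedCount F z (Function.update τ f 2) (K3 ends o a₁ a₂ a₃ b) :=
  (pmRoot_series_two_iff ends o a₁ a₂ a₃ b hef hf hleaf he h1u.symm huv huo hu2 hu3 hub F hfF heF
    z τ hτ hτe hcl).2
    (hU V E ends o a₁ a₂ a₃ b u f hf hleaf h1u h1o h12 h13 h1b huo hu2 hu3 hub (F.erase e)
      (Finset.mem_erase.2 ⟨hef.symm, hfF⟩) (Function.update z e true) τ
      (fun e' he' => hτ e' (Finset.mem_of_mem_erase he')))

end Upper

end TypedRed

end CovForm

end Summit.Ventures.PercRepro2
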